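import Summits.NavierStokesRegularity.FluidComputer.ClayBreakdownWitnessViscosity
import Summits.NavierStokesRegularity.FluidComputer.PalasekTowerClayBridgePathB
import HarnessLib

/-!
# The rate-free E–C endpoint WITHOUT a named fact: a BOUNDED breakdown witness gives Fefferman's (C)

Cell `ns-blowup`, seat `ns-blowup-fc-prover-2` (D-0074 GROUP C «bridge support»); companion of
`ClayBreakdownWitness.lean` / `ClayBreakdownWitnessViscosity.lean` (seat `ns-blowup-ecbridge-1`: the
rate-free endpoint `BreakdownWitness ν` and `navierStokesBreakdownR3_of_witness`, which consumes the
named fact `tao_unconditional_uniqueness_velocity_forced` = W14) and of `PalasekTowerClayBridgePathB.lean`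
(PATH B′: `clay_competitor_eq_of_serrinClass_B`, uniqueness of a DESIGNED solution in the Serrin class
`L⁴(0,T';L⁶)` against every Clay competitor, by the forced Serrin–Masuda weak–strong uniqueness and
Tao's forced pressure normalisation — both THEOREMS of the tree). LABEL: E–C bookkeeping. WHAT THIS
IS NOT: not Navier–Stokes evidence — an implication from a HYPOTHETICAL witness; no witness is
constructed and nothing about blow-up is asserted.

The observation: every lane of the cell produces its witness as an explicit classical solution with
CEILINGS — the tower has `|u| ≤ c₂ Y_k` on its slabs (`Realisation.norm_le_of_lt`), a triggered cascade
is glued from finitely many smooth pieces before any `T' < T*` — so the velocity is BOUNDED on every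
closed sub-slab `[0, T']`, `T' < T`. Bounded + finite energy + continuous slices is the Serrin class
`L⁴(0,T';L⁶)` (`memLqLp_four_six_of_bounded`, `PalasekTowerClayBridgeWS`), and then PATH B′ applies
verbatim. Hence:

* `BreakdownWitness.BoundedOnSlabs W` — `∀ T' < T, ∃ B, ∀ t ∈ [0, T'], ∀ x, ‖u t x‖ ≤ B`;
* `BreakdownWitness.memLqLp_four_six_of_boundedOnSlabs`, `eq_of_claySolution_B`,
  `not_exists_claySolution_B` (the witness versions of the `Realisation` lemmas of PATH B′);
* `BreakdownWitness.boundedOnSlabs_rescale` (the viscosity change `u ↦ a·u(a t, x)` keeps ceilings);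
* **`BreakdownWitness.navierStokesBreakdownR3_of_bounded : 0 < μ → (W : BreakdownWitness μ) →
  W.BoundedOnSlabs → NavierStokesBreakdownR3`** — ONE bounded witness at ONE viscosity gives
  Fefferman's (C) at every viscosity, with NO named-fact hypothesis (compare
  `navierStokesBreakdownR3_of_witness`, which needs W14).

For the TRIGGERED door (`TriggeredTransfer*`): a cascade whose `Step`s carry a sup-ceiling on their
slab (`∃ M, ∀ t ∈ [0, T+δ], ∀ x, ‖u t x‖ ≤ M` — the v2 re-typing suggested on the cell bus) glues to a
bounded witness, so `Transfers` closes (C) binder-free through this file.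

References: C. L. Fefferman, Clay problem description, (C) [cite: FeffermanClay2006, (C)]; J. Serrin,
1963, §4 and H. Sohr 2001, Thm. V.1.5.1 (forced weak–strong uniqueness, tree theorem
`serrinMasuda_weak_strong_uniqueness_forced_L4L6`) [cite: Serrin1963, §4]; T. Tao, Anal. PDE 6 (2013),
footnote 3 (viscosity scaling) [cite: Tao2011, footnote 3]. 0 sorry; axioms ⊆ {propext,
Classical.choice, Quot.sound}.
-/

noncomputable section

namespace Summit.NavierStokesRegularity.FluidComputer.PalasekTowerClayBridge

open Set MeasureTheory Filter Topology Function
open scoped ENNReal ContDiff NNReal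
open Literature.Analysis.FluidPDE
open Summit.NavierStokesRegularity.NavierStokesRegularity

namespace BreakdownWitness

variable {ν : ℝ} (W : BreakdownWitness ν)

/-- **Bounded on closed sub-slabs**: for every `T' < T` the witness velocity is bounded on
`[0, T'] × ℝ³`. (Local unboundedness as `t ↑ T` — the witness clause `unbounded` — is of course
compatible: the bound `B(T')` blows up as `T' ↑ T`.) [folklore] -/
def BoundedOnSlabs : Prop :=
  ∀ T', T' < W.T → ∃ B : ℝ, ∀ t ∈ Icc 0 T', ∀ x, ‖W.u t x‖ ≤ B

variable {W}

/-- **A bounded witness is in the Serrin class `L⁴(0, T''; L⁶)` on every `T'' ≤ T' < T`** (bounded,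
finite energy, continuous slices: `memLqLp_four_six_of_bounded`). [folklore] -/
theorem memLqLp_four_six_of_boundedOnSlabs (hB : W.BoundedOnSlabs) {T' : ℝ} (hT' : T' < W.T)
    {T'' : ℝ} (hT'' : T'' ≤ T') : MemLqLp 4 6 W.u (Ioo 0 T'') := by
  obtain ⟨B, hBB⟩ := hB T' hT'
  obtain ⟨A, hAt, hA⟩ := W.energy T' hT'
  have hsub : Icc 0 T'' ⊆ Icc 0 T' := Icc_subset_Icc le_rfl hT''
  refine memLqLp_four_six_of_bounded (fun t ht => ?_) (fun t ht => hBB t (hsub ht)) hAt.ne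
    (fun t ht => hA t (hsub ht))
  exact (W.classical.contDiff_velocity ⟨ht.1, lt_of_le_of_lt (ht.2.trans hT'') hT'⟩).continuous

/-- **Uniqueness of a bounded witness against every global Clay-class solution — PATH B′, no named
fact.** A solution `(v, q)` of the same forced system from the same datum, jointly smooth on
`[0, ∞) × ℝ³` with bounded energy, coincides with the witness on `[0, T)`: for `0 ≤ t < T` apply
`clay_competitor_eq_of_serrinClass_B` on a closed slab `[0, t']`, `t < t' < T`, where the witness is
classical, of finite energy and in `L⁴(0,·;L⁶)`. [cite: Serrin1963, §4] -/
theorem eq_of_claySolution_B (hν : 0 < ν) (hB : W.BoundedOnSlabs)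
    {v : ℝ → EuclideanSpace ℝ (Fin 3) → EuclideanSpace ℝ (Fin 3)}
    {q : ℝ → EuclideanSpace ℝ (Fin 3) → ℝ}
    (hv : IsSmoothOnHalfSpace v) (hq : IsSmoothOnHalfSpace q)
    (hns : IsNavierStokesSolution ν W.f (W.u 0) v q) (hE : HasBoundedEnergy v) :
    ∀ t ∈ Ico 0 W.T, v t = W.u t := by
  intro t ht
  obtain ⟨ht0, htT⟩ := ht
  obtain ⟨t', htt', ht'T⟩ := exists_between htT
  have ht'0 : 0 < t' := lt_of_le_of_lt ht0 htt'
  have hu' : IsClassicalNSSolutionOn (Icc 0 t') ν W.f W.u W.p :=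
    W.classical.mono (fun s hs => ⟨hs.1, lt_of_le_of_lt hs.2 ht'T⟩) (uniqueDiffOn_Icc ht'0)
  have hEu : ∃ C : ℝ≥0∞, C < ⊤ ∧ ∀ s ∈ Icc 0 t', ∫⁻ x, ‖W.u s x‖ₑ ^ 2 ≤ C := W.energy t' ht'T
  have hS : ∀ T', 0 < T' → T' < t' → MemLqLp 4 6 W.u (Ioo 0 T') :=
    fun T' _ hT' => memLqLp_four_six_of_boundedOnSlabs hB ht'T hT'.le
  exact clay_competitor_eq_of_serrinClass_B hν ht'0 W.force_smooth W.force_decay hu' hEu hS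
    hns hv hq hE t ⟨ht0, htt'.le⟩

/-- **No global Clay-class solution shares a bounded witness's datum and force — no named fact**:
such a solution would coincide with the witness on `[0, T)` (`eq_of_claySolution_B`) and be continuous
on the compact box `[0, T] × B̄(0, radius)`, which local unboundedness forbids
(`not_continuousOn_box`). [cite: FeffermanClay2006, (C)] -/
theorem not_exists_claySolution_B (hν : 0 < ν) (hB : W.BoundedOnSlabs) :
    ¬ ∃ (v : ℝ → EuclideanSpace ℝ (Fin 3) → EuclideanSpace ℝ (Fin 3))
        (q : ℝ → EuclideanSpace ℝ (Fin 3) → ℝ),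
        IsSmoothOnHalfSpace v ∧ IsSmoothOnHalfSpace q ∧
          IsNavierStokesSolution ν W.f (W.u 0) v q ∧ HasBoundedEnergy v := by
  rintro ⟨v, q, hv, hq, hns, hE⟩
  refine W.not_continuousOn_box (eq_of_claySolution_B hν hB hv hq hns hE) ?_
  have hsub : Icc (0 : ℝ) W.T ×ˢ Metric.closedBall (0 : EuclideanSpace ℝ (Fin 3)) W.radius ⊆
      Ici (0 : ℝ) ×ˢ (univ : Set (EuclideanSpace ℝ (Fin 3))) :=
    prod_mono (fun s hs => hs.1) (subset_univ _)
  exact (ContDiffOn.continuousOn hv).mono hsub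

/-- **Ceilings survive the change of viscosity** `u ↦ a·u(a t, x)`, `a = ν/μ`: the rescaled witness
(`BreakdownWitness.rescale`, blow-up time `T/a`) is bounded on `[0, T']` by `a·B(a T')`.
[cite: Tao2011, footnote 3] -/
theorem boundedOnSlabs_rescale {μ : ℝ} {W : BreakdownWitness μ} (hB : W.BoundedOnSlabs)
    (hμ : 0 < μ) (hν : 0 < ν) : (W.rescale hμ hν).BoundedOnSlabs := by
  intro T' hT'
  have ha : 0 < ν / μ := div_pos hν hμ
  change T' < W.T / (ν / μ) at hT'
  have haT' : ν / μ * T' < W.T := by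
    have := mul_lt_mul_of_pos_left hT' ha
    rwa [mul_div_cancel₀ _ ha.ne'] at this
  obtain ⟨B, hBB⟩ := hB (ν / μ * T') haT'
  refine ⟨ν / μ * B, fun t ht x => ?_⟩
  change ‖timeRescale (ν / μ) (ν / μ) W.u t x‖ ≤ ν / μ * B
  rw [timeRescale_apply, norm_smul, Real.norm_of_nonneg ha.le]
  exact mul_le_mul_of_nonneg_left
    (hBB (ν / μ * t) ⟨mul_nonneg ha.le ht.1, mul_le_mul_of_nonneg_left ht.2 ha.le⟩ x) ha.le

/-- **THE E–C ENDPOINT, RATE-FREE AND BINDER-FREE: one BOUNDED witness at one viscosity gives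
Fefferman's (C).** An exact classical solution of the forced Navier–Stokes system on `[0, T) × ℝ³`
from a Clay datum, with a Clay-class force smooth through `T`, finite energy and a velocity that is
bounded on every closed sub-slab yet locally unbounded as `t ↑ T`, at a single viscosity `μ > 0`,
implies `NavierStokesBreakdownR3`: rescale to every `ν > 0` (`BreakdownWitness.rescale`,
`boundedOnSlabs_rescale`) and read off datum, force and `not_exists_claySolution_B`. Compare
`navierStokesBreakdownR3_of_witness` (same conclusion from an UNBOUNDED-on-slabs witness, but needing
the named fact W14). HONEST FRAMING: an implication from a hypothetical object; no witness exists in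
the tree. [cite: FeffermanClay2006, (C)] -/
theorem navierStokesBreakdownR3_of_bounded {μ : ℝ} (hμ : 0 < μ) (W : BreakdownWitness μ)
    (hB : W.BoundedOnSlabs) :
    Summit.NavierStokesRegularity.NavierStokesRegularity.NavierStokesBreakdownR3 := by
  intro ν hν
  set W' := W.rescale hμ hν with hW'
  have hB' : W'.BoundedOnSlabs := boundedOnSlabs_rescale hB hμ hν
  exact ⟨W'.u 0, W'.f, W'.classical.contDiff_velocity (t := 0) ⟨le_rfl, W'.T_pos⟩,
    W'.classical.divFree 0 ⟨le_rfl, W'.T_pos⟩, W'.datum_decay, W'.force_smooth, W'.force_decay,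
    not_exists_claySolution_B hν hB'⟩

/-- The Literature spelling of (C) from a bounded witness. [cite: FeffermanClay2006, (C)] -/
theorem literature_navierStokesBreakdownR3_of_bounded {μ : ℝ} (hμ : 0 < μ) (W : BreakdownWitness μ)
    (hB : W.BoundedOnSlabs) : Literature.Analysis.FluidPDE.NavierStokesBreakdownR3 :=
  navierStokesBreakdownR3_iff_literature.1 (navierStokesBreakdownR3_of_bounded hμ W hB)

/-- **A realised tower is a bounded witness** (its ceilings `c₂ Y_k`, `Realisation.norm_le_of_lt`), so
PATH B′ for towers (`navierStokesBreakdownR3_at_of_realisation_B`) is the special case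
`Realisation.toWitness` of `navierStokesBreakdownR3_of_bounded`. [cite: Palasek2026ElementaryModel, §4] -/
theorem _root_.Summit.NavierStokesRegularity.FluidComputer.PalasekTowerClayBridge.Realisation.boundedOnSlabs_toWitness
    {R : TowerRates} (Wr : Realisation ν R) : Wr.toWitness.BoundedOnSlabs :=
  fun _ hT' => Wr.norm_le_of_lt hT'

end BreakdownWitness

namespace BreakdownWitness

variable {ν : ℝ} {W : BreakdownWitness ν}

/-- The half-open form of `BoundedOnSlabs`: bounded on `[0, T') × ℝ³` for every `T' < T` (equivalent,
since every `T' < T` lies below some `T'' ∈ (T', T)`). ERRATUM to the module docstring (v1): a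
classical solution glued from finitely many SMOOTH pieces on compact time slabs is bounded on closed
sub-slabs only when each piece carries a sup-ceiling over `ℝ³` — joint smoothness alone does not bound a
field on the non-compact `[0, T'] × ℝ³`; for the triggered cascade that ceiling is the clause of
`TriggerScheme.StepB` (`TriggeredTransferBounded.lean`), under which `TriggeredTransferBoundedWitness`
proves `BoundedOnSlabs` of the glued witness. [folklore] -/
theorem boundedOnSlabs_iff_Ico :
    W.BoundedOnSlabs ↔ ∀ T', T' < W.T → ∃ B : ℝ, ∀ t ∈ Ico 0 T', ∀ x, ‖W.u t x‖ ≤ B := by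
  constructor
  · intro h T' hT'
    obtain ⟨B, hB⟩ := h T' hT'
    exact ⟨B, fun t ht x => hB t ⟨ht.1, ht.2.le⟩ x⟩
  · intro h T' hT'
    obtain ⟨T'', h1, h2⟩ := exists_between hT'
    obtain ⟨B, hB⟩ := h T'' h2
    exact ⟨B, fun t ht x => hB t ⟨ht.1, lt_of_le_of_lt ht.2 h1⟩ x⟩

end BreakdownWitness

end Summit.NavierStokesRegularity.FluidComputer.PalasekTowerClayBridge

end
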